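import Literature.NumberTheory.Automorphic.RankinSelbergLocalGLOne
import Literature.NumberTheory.Automorphic.TateLocalZetaShells
import Literature.NumberTheory.Automorphic.WhittakerBesselGL2
import Literature.NumberTheory.Automorphic.CuspFormFourierExpansionGL2Inputs
import HarnessLib

/-!
# The new-vector Whittaker recursion on the torus of `GL₂(F)` and its zeta integral with a pole

Topic `Literature/NumberTheory/EllipticCurves`, proof file (theorems only: no definition, no
named fact, no instance), part L of the road from Carayol's local–global compatibility
(`Automorphic.galoisRep_GL2_totallyReal_localGlobal`) to Hida 2000, Thm. 3.26 (3)(a)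
(`Hida2000_thm326_inertia_of_level`): the LOCAL computation which replaces Casselman's
new-vector theory.

Let `F` be a non-archimedean local field, `q = #k_F`, `|·| = |·|_F`, `ψ : F → 𝕊` an additive
character trivial on `𝒪_F = {|x| ≤ 1}`, and `W : GL₂(F) → ℂ` a function with
`W(n(x) g) = ψ(x) W(g)` (`n(x) = (1 x; 0 1)`), right invariant under `n(t)`, `|t| ≤ 1`, and
satisfying a `U`-eigen-equation `∑_{i ∈ ι} W(g n(b_i) d(ϖ, 1)) = λ W(g)` for finitely many
`b_i ∈ 𝒪_F` (for the local component of the adelic newform of level `ℓ^e ∥ N` these are the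
`ℓ` translates by `(ℓ j; 0 1)`, `0 ≤ j < ℓ`, and `λ = ℓ^{1-k/2} a_ℓ` — Gelbart 1975, Lemma 3.7;
classically `a_{ℓ^{m+1}} = a_ℓ a_{ℓ^m}` for a `U_ℓ`-eigenform).  Then on the torus
(`whittaker_torus_recursion`, `whittaker_torus_pow`):

  `#ι · W(d(a ϖ, 1)) = λ · W(d(a, 1))` (`|a| ≤ 1`),  so  `W(d(ϖ^m, 1)) = (λ/#ι)^m W(1)`,

and `W(d(a, 1)) = 0` for `|a| > 1` as soon as `ψ` is non-trivial on `𝔭⁻¹`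
(`whittaker_torus_eq_zero`).  Consequently the `GL₂ × GL₁` Rankin–Selberg zeta integral of `W`
against a constant function (the Whittaker function of the trivial representation of `GL₁(F)`),
for the invariant measure on `GL₁(F) ⧸ U₁ = Fˣ` transported from a Haar measure of `Fˣ`, is the
geometric series `A / (1 - c q^{1/2} q^{-s})` (`A ≠ 0` when `W(1) ≠ 0`), which is not a Laurent
polynomial in `q^{-s}` (`exists_measure_rsZeta_not_laurent`): this is the witness `hZ` consumed by
`Hida2000Thm326.inertia_of_level_of_localGlobal_of_rsZeta_not_laurent`
(`EisensteinNewformLevelRaisingInertiaLFactorProofs`).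

## References

* H. Jacquet, R. P. Langlands, *Automorphic forms on GL(2)*, LNM 114 (1970), Prop. 3.5 (zeta
  integrals of principal series) [JacquetLanglands1970].
* W. Casselman, *On some results of Atkin and Lehner*, Math. Ann. 201 (1973), Thm. 1 (the
  statement replaced here by a global argument) [Casselman1973].
* S. Gelbart, *Automorphic forms on adele groups* (1975), Lemma 3.7 [Gelbart1975].
* H. Hida, *Modular forms and Galois cohomology* (2000), Thm. 3.26 (3)(a) [Hida2000].
-/

noncomputable section

open scoped MatrixGroups NNReal ENNReal
open MeasureTheory ValuativeRel Polynomial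
  Literature.NumberTheory.GaloisRepresentations.IsNonarchimedeanLocalField
  Literature.NumberTheory.Automorphic

namespace Literature.NumberTheory.EllipticCurves.Hida2000Thm326

/-! ### Part L1: the torus recursion (pure algebra) -/

section Recursion

variable {F : Type*} [Field F] [ValuativeRel F] [TopologicalSpace F] [IsNonarchimedeanLocalField F]

/-- **The new-vector recursion on the torus.** If `W(n(x) g) = ψ(x) W(g)`, `ψ` is trivial on
`𝒪_F`, and `∑_i W(g n(b_i) d(ϖ, 1)) = λ W(g)` with all `|b_i| ≤ 1`, then for `|a| ≤ 1`:
`#ι · W(d(a ϖ, 1)) = λ · W(d(a, 1))` (`d(a, 1) n(b) = n(a b) d(a, 1)` and `ψ(a b_i) = 1`).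
[cite: Gelbart1975, Lemma 3.7] [cite: JacquetLanglands1970, Prop. 3.5] -/
theorem whittaker_torus_recursion {ψ : AddChar F Circle} (hψ : ∀ x : F, normAbs F x ≤ 1 → ψ x = 1)
    {W : GL (Fin 2) F → ℂ}
    (hN : ∀ (x : F) (g : GL (Fin 2) F),
      W (((unipotentGL2 x : ↥(upperUnitriangular (Fin 2) F)) : GL (Fin 2) F) * g) = ψ x * W g)
    {ι : Type*} [Fintype ι] {b : ι → F} (hb : ∀ i, normAbs F (b i) ≤ 1) {ϖ : Fˣ} {lam : ℂ}
    (hU : ∀ g : GL (Fin 2) F,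
      ∑ i, W (g * (((unipotentGL2 (b i) : ↥(upperUnitriangular (Fin 2) F)) : GL (Fin 2) F) *
        diagGL2 ϖ 1)) = lam * W g)
    (a : Fˣ) (ha : normAbs F (a : F) ≤ 1) :
    (Fintype.card ι : ℂ) * W (diagGL2 (a * ϖ) 1) = lam * W (diagGL2 a 1) := by
  have h := hU (diagGL2 a 1)
  have hterm : ∀ i, W (diagGL2 a 1 *
      (((unipotentGL2 (b i) : ↥(upperUnitriangular (Fin 2) F)) : GL (Fin 2) F) * diagGL2 ϖ 1)) =
      W (diagGL2 (a * ϖ) 1) := by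
    intro i
    rw [← mul_assoc, diagGL2_mul_unipotentGL2, mul_assoc, ← diagGL2_mul, mul_one, hN,
      hψ _ ?_, Circle.coe_one, one_mul]
    rw [map_mul]
    exact mul_le_one' ha (hb i)
  simp only [hterm, Finset.sum_const, Finset.card_univ, nsmul_eq_mul] at h
  exact h

/-- **`W(d(ϖ^m, 1)) = (λ / #ι)^m W(1)`** under the hypotheses of `whittaker_torus_recursion`,
for `|ϖ| ≤ 1` and `ι` non-empty. [cite: Gelbart1975, Lemma 3.7] -/
theorem whittaker_torus_pow {ψ : AddChar F Circle} (hψ : ∀ x : F, normAbs F x ≤ 1 → ψ x = 1)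
    {W : GL (Fin 2) F → ℂ}
    (hN : ∀ (x : F) (g : GL (Fin 2) F),
      W (((unipotentGL2 x : ↥(upperUnitriangular (Fin 2) F)) : GL (Fin 2) F) * g) = ψ x * W g)
    {ι : Type*} [Fintype ι] [Nonempty ι] {b : ι → F} (hb : ∀ i, normAbs F (b i) ≤ 1) {ϖ : Fˣ}
    (hϖ : normAbs F (ϖ : F) ≤ 1) {lam : ℂ}
    (hU : ∀ g : GL (Fin 2) F,
      ∑ i, W (g * (((unipotentGL2 (b i) : ↥(upperUnitriangular (Fin 2) F)) : GL (Fin 2) F) *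
        diagGL2 ϖ 1)) = lam * W g)
    (m : ℕ) : W (diagGL2 (ϖ ^ m) 1) = (lam / Fintype.card ι) ^ m * W 1 := by
  have hcard : (Fintype.card ι : ℂ) ≠ 0 := Nat.cast_ne_zero.mpr Fintype.card_ne_zero
  induction m with
  | zero => rw [pow_zero, pow_zero, one_mul, diagGL2_one]
  | succ m ih =>
    have hm : normAbs F ((ϖ ^ m : Fˣ) : F) ≤ 1 := by
      rw [Units.val_pow_eq_pow_val, map_pow]
      exact pow_le_one₀ (by positivity) hϖ
    have h := whittaker_torus_recursion hψ hN hb hU (ϖ ^ m) hm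
    have hX : W (diagGL2 (ϖ ^ m * ϖ) 1) = lam / Fintype.card ι * W (diagGL2 (ϖ ^ m) 1) := by
      rw [div_mul_eq_mul_div, eq_div_iff hcard, mul_comm]
      exact h
    rw [pow_succ, hX, ih, pow_succ]
    ring

/-- Right invariance under `d(u, 1)`, `|u| = 1`, makes `W(d(·, 1))` constant on the shells:
`W(d(ϖ^m u, 1)) = W(d(ϖ^m, 1))`. [folklore] -/
theorem whittaker_torus_unit {W : GL (Fin 2) F → ℂ}
    (hd : ∀ u : Fˣ, normAbs F (u : F) = 1 → ∀ g : GL (Fin 2) F, W (g * diagGL2 u 1) = W g)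
    (ϖ : Fˣ) (m : ℕ) (u : Fˣ) (hu : normAbs F (u : F) = 1) :
    W (diagGL2 (ϖ ^ m * u) 1) = W (diagGL2 (ϖ ^ m) 1) := by
  rw [show diagGL2 (ϖ ^ m * u) 1 = diagGL2 (ϖ ^ m) 1 * diagGL2 u 1 by
    rw [← diagGL2_mul, mul_one], hd u hu]

/-- **Vanishing off `𝒪_F`.** If `W(n(x) g) = ψ(x) W(g)`, `W` is right invariant under `n(t)`,
`|t| ≤ 1`, and for every `|a| > 1` some `t ∈ 𝒪_F` has `ψ(a t) ≠ 1` (i.e. `ψ` is non-trivial on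
`𝔭⁻¹`), then `W(d(a, 1)) = 0` for `|a| > 1`: `W(d(a,1)) = W(d(a,1) n(t)) = ψ(a t) W(d(a,1))`.
[cite: JacquetLanglands1970, Prop. 3.5] -/
theorem whittaker_torus_eq_zero {ψ : AddChar F Circle} {W : GL (Fin 2) F → ℂ}
    (hN : ∀ (x : F) (g : GL (Fin 2) F),
      W (((unipotentGL2 x : ↥(upperUnitriangular (Fin 2) F)) : GL (Fin 2) F) * g) = ψ x * W g)
    (hn : ∀ t : F, normAbs F t ≤ 1 → ∀ g : GL (Fin 2) F,
      W (g * ((unipotentGL2 t : ↥(upperUnitriangular (Fin 2) F)) : GL (Fin 2) F)) = W g)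
    (hψ' : ∀ a : F, 1 < normAbs F a → ∃ t : F, normAbs F t ≤ 1 ∧ ψ (a * t) ≠ 1)
    (a : Fˣ) (ha : 1 < normAbs F (a : F)) : W (diagGL2 a 1) = 0 := by
  obtain ⟨t, ht, hat⟩ := hψ' a ha
  have h := hn t ht (diagGL2 a 1)
  rw [diagGL2_mul_unipotentGL2, hN] at h
  have h' : ((ψ ((a : F) * t) : ℂ) - 1) * W (diagGL2 a 1) = 0 := by
    rw [sub_mul, one_mul, h, sub_self]
  rcases mul_eq_zero.mp h' with h1 | h1
  · exact absurd (Subtype.ext (by simpa [sub_eq_zero] using h1)) hat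
  · exact h1

/-- An additive character of conductor exponent `0` (`AddChar.HasConductorExp ψ 0`: trivial on
`𝒪_F`, non-trivial on `𝔭⁻¹`) is trivial on `{|x| ≤ 1}`. [folklore] -/
theorem addChar_eq_one_of_hasConductorExp_zero {ψ : AddChar F Circle} (hψ : ψ.HasConductorExp 0)
    (x : F) (hx : normAbs F x ≤ 1) : ψ x = 1 :=
  hψ.1 x (by rw [mem_primePowBall_iff, zpow_zero]; exact hx)

/-- For `ψ` of conductor exponent `0` and `|a| > 1` there is `t ∈ 𝒪_F` with `ψ(a t) ≠ 1`
(`|a| ≥ q`, and `ψ(x₀) ≠ 1` for some `|x₀| ≤ q`; take `t = x₀ / a`). [folklore] -/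
theorem exists_addChar_mul_ne_one_of_hasConductorExp_zero {ψ : AddChar F Circle}
    (hψ : ψ.HasConductorExp 0) (a : F) (ha : 1 < normAbs F a) :
    ∃ t : F, normAbs F t ≤ 1 ∧ ψ (a * t) ≠ 1 := by
  obtain ⟨x₀, hx₀, hψx₀⟩ := hψ.2
  have ha0 : a ≠ 0 := fun h => by simp [h] at ha
  -- `|a| ≥ q`
  obtain ⟨k, hk⟩ := exists_normAbs_eq_inv_zpow ha0
  have hk1 : k ≤ -1 := by
    by_contra hk'
    push Not at hk'
    have h0 : (0 : ℤ) ≤ k := by omega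
    have : normAbs F a ≤ 1 := by
      rw [hk, ← zpow_zero ((residueFieldCard F : ℝ≥0)⁻¹), inv_residueFieldCard_zpow_le_iff]
      exact h0
    exact absurd ha (not_lt.mpr this)
  have hqa : ((residueFieldCard F : ℝ≥0)⁻¹) ^ (-1 : ℤ) ≤ normAbs F a := by
    rw [hk, inv_residueFieldCard_zpow_le_iff]
    exact hk1
  refine ⟨x₀ * a⁻¹, ?_, by rwa [mul_comm, inv_mul_cancel_right₀ ha0]⟩
  rw [map_mul, map_inv₀]
  rw [mem_primePowBall_iff, zero_sub] at hx₀
  have hapos : 0 < normAbs F a := lt_trans zero_lt_one ha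
  rw [mul_inv_le_iff₀ hapos, one_mul]
  exact hx₀.trans hqa

end Recursion

/-! ### Part L2: the invariant measure on `GL₁(F) ⧸ U₁ = Fˣ` -/

section GLOne

variable {F : Type*} [Field F]

/-- A `1 × 1` invertible matrix is the diagonal matrix of its determinant. [folklore] -/
theorem glDiagonal_det_eq (g : GL (Fin 1) F) :
    glDiagonal 1 F (fun _ => Matrix.GeneralLinearGroup.det g) = g := by
  refine Units.ext (Matrix.ext fun i j => ?_)
  have hi : i = 0 := Subsingleton.elim i 0
  have hj : j = 0 := Subsingleton.elim j 0
  subst hi; subst hj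
  rw [coe_glDiagonal, Matrix.diagonal_apply_eq, Matrix.GeneralLinearGroup.val_det_apply,
    Matrix.det_fin_one]

/-- `det (glDiagonal (fun _ => a)) = a` on `GL₁`. [folklore] -/
theorem det_glDiagonal_fin_one (a : Fˣ) :
    Matrix.GeneralLinearGroup.det (glDiagonal 1 F fun _ => a) = a := by
  refine Units.ext ?_
  rw [Matrix.GeneralLinearGroup.val_det_apply, coe_glDiagonal, Matrix.det_diagonal,
    Fin.prod_univ_one]

end GLOne

section Measure

variable {F : Type*} [Field F] [ValuativeRel F] [TopologicalSpace F] [IsNonarchimedeanLocalField F]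
  [MeasurableSpace F] [BorelSpace F]
  [MeasurableSpace (GL (Fin 1) F ⧸ upperUnitriangular (Fin 1) F)]
  [BorelSpace (GL (Fin 1) F ⧸ upperUnitriangular (Fin 1) F)]

/-- **The invariant measure on `GL₁(F) ⧸ U₁`.** There are a Haar measure `μ'` on `Fˣ` and a
`GL₁(F)`-invariant Borel measure `ν` on `GL₁(F) ⧸ U₁`, finite on compacts and positive on opens,
such that `∫ f dν = ∫_{Fˣ} f([a]) dμ'(a)` for every `f` (transport along the homeomorphism
`a ↦ [diag(a)]`, `U₁` being trivial). [folklore] -/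
theorem exists_haar_measure_quotient_fin_one :
    ∃ (μ' : Measure Fˣ) (_ : μ'.IsHaarMeasure)
      (ν : Measure (GL (Fin 1) F ⧸ upperUnitriangular (Fin 1) F)),
      SMulInvariantMeasure (GL (Fin 1) F) (GL (Fin 1) F ⧸ upperUnitriangular (Fin 1) F) ν ∧
      IsFiniteMeasureOnCompacts ν ∧ ν.IsOpenPosMeasure ∧
      ∀ f : GL (Fin 1) F ⧸ upperUnitriangular (Fin 1) F → ℂ,
        ∫ x, f x ∂ν = ∫ a : Fˣ, f (QuotientGroup.mk (glDiagonal 1 F fun _ => a)) ∂μ' := by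
  haveI : T2Space F :=
    (Literature.NumberTheory.GaloisRepresentations.IsNonarchimedeanLocalField.isLocalField F).toT2Space
  haveI : BorelSpace Fˣ := Units.borelSpace
  -- the embedding `d : Fˣ →* GL₁(F)` and the homeomorphism `Fˣ ≃ₜ GL₁(F) ⧸ U₁`
  set d : Fˣ →* GL (Fin 1) F :=
    (glDiagonal 1 F).comp ⟨⟨fun a _ => a, rfl⟩, fun _ _ => rfl⟩ with hd
  have hd_apply : ∀ a, d a = glDiagonal 1 F (fun _ => a) := fun a => rfl
  have hdet : ∀ a, Matrix.GeneralLinearGroup.det (d a) = a := fun a => by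
    rw [hd_apply, det_glDiagonal_fin_one]
  have hd_det : ∀ g : GL (Fin 1) F, d (Matrix.GeneralLinearGroup.det g) = g := fun g => by
    rw [hd_apply, glDiagonal_det_eq]
  have hdc : Continuous d := by
    refine Units.continuous_iff.2 ⟨?_, ?_⟩
    · show Continuous fun a : Fˣ => ((d a : GL (Fin 1) F) : Matrix (Fin 1) (Fin 1) F)
      have : (fun a : Fˣ => ((d a : GL (Fin 1) F) : Matrix (Fin 1) (Fin 1) F)) =
          fun a : Fˣ => Matrix.diagonal fun _ : Fin 1 => (a : F) :=
        funext fun a => by rw [hd_apply, coe_glDiagonal]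
      rw [this]
      exact (continuous_pi fun _ => Units.continuous_val).matrix_diagonal
    · show Continuous fun a : Fˣ => ((↑(d a)⁻¹ : Matrix (Fin 1) (Fin 1) F))
      have : (fun a : Fˣ => ((↑(d a)⁻¹ : Matrix (Fin 1) (Fin 1) F))) =
          fun a : Fˣ => Matrix.diagonal fun _ : Fin 1 => ((a⁻¹ : Fˣ) : F) := funext fun a => by
        rw [← map_inv, hd_apply, coe_glDiagonal]
      rw [this]
      exact (continuous_pi fun _ => Units.continuous_coe_inv).matrix_diagonal
  have hdetc : Continuous (Matrix.GeneralLinearGroup.det : GL (Fin 1) F → Fˣ) := by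
    refine Units.continuous_iff.2 ⟨?_, ?_⟩
    · show Continuous fun g : GL (Fin 1) F => ((Matrix.GeneralLinearGroup.det g : Fˣ) : F)
      exact (continuous_id.matrix_det).comp Units.continuous_val
    · show Continuous fun g : GL (Fin 1) F => ((↑(Matrix.GeneralLinearGroup.det g)⁻¹ : F))
      have : (fun g : GL (Fin 1) F => ((↑(Matrix.GeneralLinearGroup.det g)⁻¹ : F))) =
          fun g : GL (Fin 1) F => ((↑(g⁻¹) : Matrix (Fin 1) (Fin 1) F)).det := funext fun g => by
        rw [← map_inv, Matrix.GeneralLinearGroup.val_det_apply]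
      rw [this]
      exact (continuous_id.matrix_det).comp Units.continuous_coe_inv
  have hcompat : ∀ a b : GL (Fin 1) F, QuotientGroup.leftRel (upperUnitriangular (Fin 1) F) a b →
      Matrix.GeneralLinearGroup.det a = Matrix.GeneralLinearGroup.det b := by
    intro a b hab
    rw [QuotientGroup.leftRel_apply] at hab
    have h1 : a⁻¹ * b = 1 := upperUnitriangular_fin_one_coe_eq_one ⟨a⁻¹ * b, hab⟩
    rw [inv_mul_eq_one] at h1
    rw [h1]
  set einv : GL (Fin 1) F ⧸ upperUnitriangular (Fin 1) F → Fˣ :=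
    Quotient.lift (Matrix.GeneralLinearGroup.det) hcompat with heinv
  have heinv_mk : ∀ g : GL (Fin 1) F,
      einv (QuotientGroup.mk g) = Matrix.GeneralLinearGroup.det g := fun g => rfl
  set e : Fˣ ≃ₜ GL (Fin 1) F ⧸ upperUnitriangular (Fin 1) F :=
    { toFun := fun a => QuotientGroup.mk (d a)
      invFun := einv
      left_inv := fun a => by
        change einv (QuotientGroup.mk (d a)) = a
        rw [heinv_mk, hdet]
      right_inv := fun x => by
        induction x using QuotientGroup.induction_on with
        | H g =>
          change (QuotientGroup.mk (d (einv (QuotientGroup.mk g))) :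
            GL (Fin 1) F ⧸ upperUnitriangular (Fin 1) F) = QuotientGroup.mk g
          rw [heinv_mk, hd_det]
      continuous_toFun := QuotientGroup.continuous_mk.comp hdc
      continuous_invFun := continuous_quot_lift _ hdetc } with he
  -- the measures
  set μ' : Measure Fˣ := Measure.haar with hμ'
  set ν : Measure (GL (Fin 1) F ⧸ upperUnitriangular (Fin 1) F) := Measure.map e μ' with hν
  have hme : MeasurableEmbedding e := e.measurableEmbedding
  have hν_apply : ∀ s : Set (GL (Fin 1) F ⧸ upperUnitriangular (Fin 1) F),
      ν s = μ' (e ⁻¹' s) := fun s => hme.map_apply μ' s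
  refine ⟨μ', inferInstance, ν, ⟨fun c s _ => ?_⟩, ⟨fun K hK => ?_⟩, ⟨fun U hU hne => ?_⟩,
    fun f => ?_⟩
  · -- invariance: `c • [d a] = [d (det c · a)]`
    rw [hν_apply, hν_apply, ← Set.preimage_comp]
    have hcomp : ((fun x : GL (Fin 1) F ⧸ upperUnitriangular (Fin 1) F => c • x) ∘ e) =
        e ∘ fun a : Fˣ => Matrix.GeneralLinearGroup.det c * a := by
      funext a
      change c • (QuotientGroup.mk (d a) : GL (Fin 1) F ⧸ upperUnitriangular (Fin 1) F) =
        QuotientGroup.mk (d (Matrix.GeneralLinearGroup.det c * a))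
      rw [map_mul, hd_det]
      rfl
    rw [hcomp, Set.preimage_comp, measure_preimage_mul]
  · rw [hν_apply]
    exact (e.isCompact_preimage.2 hK).measure_lt_top
  · rw [hν_apply]
    exact (hU.preimage e.continuous).measure_ne_zero μ' (hne.preimage e.surjective)
  · rw [hν, hme.integral_map]
    rfl

end Measure

/-! ### Part L3: integrals of shell-constant functions on `Fˣ` -/

section Shells

variable {F : Type*} [Field F] [ValuativeRel F] [TopologicalSpace F] [IsNonarchimedeanLocalField F]
  [MeasurableSpace F] [BorelSpace F]

/-- **Integral of a shell-constant function supported in `𝒪_F`.** If `f : Fˣ → ℂ` vanishes on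
`|x| > 1`, takes the value `v m` on the shell `|x| = q^{-m}` (`m ∈ ℕ`), and `∑ ‖v m‖ < ∞`, then for
a left-invariant measure `μ'` finite on compacts `∫ f dμ' = μ'(𝒪ˣ) · ∑_m v m`
(Tate 1950, §2.5: `∫_{A_ν} dα = ∫_U dα`). [cite: Tate1950, §2.5] -/
theorem integral_units_eq_tsum_shell (μ' : Measure Fˣ) [IsFiniteMeasureOnCompacts μ']
    [μ'.IsMulLeftInvariant] {f : Fˣ → ℂ} {v : ℕ → ℂ}
    (hf0 : ∀ x : Fˣ, 1 < normAbs F (x : F) → f x = 0)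
    (hfv : ∀ (m : ℕ) (x : Fˣ), normAbs F (x : F) = ((residueFieldCard F : ℝ≥0)⁻¹) ^ (m : ℤ) → f x = v m)
    (hv : Summable fun m => ‖v m‖) :
    ∫ x, f x ∂μ' = (μ' {x : Fˣ | valuation F (x : F) = 1}).toReal * ∑' m, v m := by
  set S : ℕ → Set Fˣ := fun m => {x : Fˣ | normAbs F (x : F) = ((residueFieldCard F : ℝ≥0)⁻¹) ^ (m : ℤ)}
    with hS
  have hSm : ∀ m, MeasurableSet (S m) := fun m => measurableSet_normAbs_shell (m : ℤ)
  have hSμ : ∀ m, μ' (S m) = μ' {x : Fˣ | valuation F (x : F) = 1} := fun m => measure_shell μ' (m : ℤ)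
  have hfin : μ' {x : Fˣ | valuation F (x : F) = 1} < ∞ := measure_unitSphere_lt_top μ'
  have hdisj : ∀ m m' : ℕ, m ≠ m' → Disjoint (S m) (S m') := fun m m' h =>
    pairwise_disjoint_shell (F := F) (show (m : ℤ) ≠ m' by exact_mod_cast h)
  -- `f` is the pointwise sum of the indicator functions of the shells
  have hpt : ∀ x : Fˣ, f x = ∑' m, (S m).indicator (fun _ => v m) x := by
    intro x
    obtain ⟨k, hk⟩ := exists_normAbs_eq_inv_zpow x.ne_zero
    by_cases hk0 : 0 ≤ k
    · -- `x` lies in the shell `m = k.toNat`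
      obtain ⟨m, rfl⟩ : ∃ m : ℕ, k = m := ⟨k.toNat, (Int.toNat_of_nonneg hk0).symm⟩
      have hxm : x ∈ S m := hk
      rw [tsum_eq_single m fun m' hm' => Set.indicator_of_notMem
        (fun h => (Set.disjoint_left.1 (hdisj m m' (Ne.symm hm')) hxm h)) _,
        Set.indicator_of_mem hxm, hfv m x hk]
    · -- `|x| > 1`: everything vanishes
      have hx1 : 1 < normAbs F (x : F) := by
        rw [hk, ← zpow_zero ((residueFieldCard F : ℝ≥0)⁻¹)]
        exact (zpow_right_strictAnti₀ inv_residueFieldCard_pos inv_residueFieldCard_lt_one)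
          (lt_of_not_ge hk0)
      rw [hf0 x hx1, eq_comm]
      have hzero : (fun m => (S m).indicator (fun _ => v m) x) = fun _ => 0 := by
        funext m
        refine Set.indicator_of_notMem (fun hxm => ?_) _
        have h := inv_residueFieldCard_zpow_injective (hk.symm.trans hxm)
        omega
      rw [hzero, tsum_zero]
  have hfeq : f = fun x => ∑' m, (S m).indicator (fun _ => v m) x := funext hpt
  rw [hfeq, integral_tsum (fun m => (aestronglyMeasurable_const.indicator (hSm m)))]
  · simp_rw [integral_indicator_const _ (hSm _), measureReal_def, hSμ, Complex.real_smul]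
    exact tsum_mul_left
  · -- `∑ ∫ ‖1_{S_m} v_m‖ = μ'(𝒪ˣ) ∑ ‖v m‖ < ∞`
    have h1 : ∀ m, ∫⁻ x, ‖(S m).indicator (fun _ => v m) x‖ₑ ∂μ' =
        ‖v m‖ₑ * μ' {x : Fˣ | valuation F (x : F) = 1} := by
      intro m
      rw [← hSμ m, ← lintegral_indicator_const (hSm m)]
      congr 1
      funext x
      by_cases hx : x ∈ S m <;> simp [hx]
    simp_rw [h1]
    rw [ENNReal.tsum_mul_right]
    refine ENNReal.mul_ne_top ?_ hfin.ne
    have hv' : Summable fun m => ‖v m‖₊ := NNReal.summable_coe.1 hv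
    simpa only [enorm_eq_nnnorm] using ENNReal.tsum_coe_ne_top_iff_summable.2 hv'

end Shells


/-! ### Part L4: the zeta integral of a torus-geometric Whittaker function -/

section Zeta

variable {F : Type*} [Field F] [ValuativeRel F] [TopologicalSpace F] [IsNonarchimedeanLocalField F]

/-- `((a ^ m : ℝ) : ℂ) ^ r = ((a : ℂ) ^ r) ^ m` for `0 ≤ a` (positive real bases have no branch
problem). [folklore] -/
theorem ofReal_pow_cpow {a : ℝ} (ha : 0 ≤ a) (m : ℕ) (r : ℂ) :
    (((a ^ m : ℝ)) : ℂ) ^ r = ((a : ℂ) ^ r) ^ m := by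
  induction m with
  | zero => simp
  | succ m ih =>
    rw [pow_succ, Complex.ofReal_mul, Complex.mul_cpow_ofReal_nonneg (pow_nonneg ha m) ha, ih,
      pow_succ]

/-- **The Rankin–Selberg integrand at a `1 × 1` diagonal matrix** (`n = 2`, `m = 1`):
`rsIntegrand W W' s (diag a) = W(d(a⁻¹, 1)) W'(diag a⁻¹) |a⁻¹|^{s - 1/2}`. [folklore] -/
theorem rsIntegrand_glDiagonal_fin_one (W : GL (Fin 2) F → ℂ) (W' : GL (Fin 1) F → ℂ) (s : ℂ)
    (a : Fˣ) :
    rsIntegrand Nat.one_lt_two W W' s (glDiagonal 1 F fun _ => a) =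
      W (diagGL2 a⁻¹ 1) * W' (glDiagonal 1 F fun _ => a⁻¹) *
        (((normAbs F ((a⁻¹ : Fˣ) : F) : ℝ≥0) : ℝ) : ℂ) ^ (s - 1 / 2) := by
  have hinv : (glDiagonal 1 F fun _ => a)⁻¹ = glDiagonal 1 F fun _ => a⁻¹ := by
    rw [← map_inv]; rfl
  have hexp : (s - (((2 : ℕ) : ℂ) - ((1 : ℕ) : ℂ)) / 2) = s - 1 / 2 := by push_cast; ring
  rw [rsIntegrand, hinv, glCorner_one_eq_diagGL2, det_glDiagonal_fin_one, hexp]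

variable [MeasurableSpace F] [BorelSpace F]

/-- **The torus integral of a new-vector Whittaker function is geometric.** If `W(d(a,1)) = 0`
for `|a| > 1` and `W(d(ϖ^m u, 1)) = c^m W(1)` (`|ϖ| = q⁻¹`, `|u| = 1`), then for
`z = c · (q⁻¹)^{s - 1/2}` of norm `< 1`,
`∫_{Fˣ} W(d(a,1)) κ |a|^{s-1/2} dμ'(a) = μ'(𝒪ˣ) κ W(1) / (1 - z)`
(Jacquet–Langlands 1970, Prop. 3.5: the zeta integral of the new vector of `π(μ₁, μ₂)`, `μ₁`
unramified, is `L(s, μ₁)` up to a constant). [cite: JacquetLanglands1970, Prop. 3.5] -/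
theorem integral_torus_whittaker_eq (μ' : Measure Fˣ) [IsFiniteMeasureOnCompacts μ']
    [μ'.IsMulLeftInvariant] {W : GL (Fin 2) F → ℂ} {ϖ : Fˣ}
    (hϖ : normAbs F (ϖ : F) = (residueFieldCard F : ℝ≥0)⁻¹) {c : ℂ}
    (h0 : ∀ a : Fˣ, 1 < normAbs F (a : F) → W (diagGL2 a 1) = 0)
    (h1 : ∀ (m : ℕ) (u : Fˣ), normAbs F (u : F) = 1 → W (diagGL2 (ϖ ^ m * u) 1) = c ^ m * W 1)
    (κ : ℂ) (s : ℂ)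
    (hz : ‖c * ((((residueFieldCard F : ℝ≥0)⁻¹ : ℝ≥0) : ℝ) : ℂ) ^ (s - 1 / 2)‖ < 1) :
    ∫ a : Fˣ, W (diagGL2 a 1) * κ * (((normAbs F (a : F) : ℝ≥0) : ℝ) : ℂ) ^ (s - 1 / 2) ∂μ' =
      (μ' {x : Fˣ | valuation F (x : F) = 1}).toReal * (κ * W 1 *
        (1 - c * ((((residueFieldCard F : ℝ≥0)⁻¹ : ℝ≥0) : ℝ) : ℂ) ^ (s - 1 / 2))⁻¹) := by
  set x : ℝ := (((residueFieldCard F : ℝ≥0)⁻¹ : ℝ≥0) : ℝ) with hx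
  have hx0 : 0 ≤ x := NNReal.coe_nonneg _
  set z : ℂ := c * (x : ℂ) ^ (s - 1 / 2) with hzdef
  rw [← tsum_geometric_of_norm_lt_one hz, ← tsum_mul_left]
  refine integral_units_eq_tsum_shell μ' (v := fun m => κ * W 1 * z ^ m) (fun a ha => ?_)
    (fun m a ha => ?_) ?_
  · rw [h0 a ha, zero_mul, zero_mul]
  · -- on the shell `|a| = q^{-m}`: `a = ϖ^m u` with `|u| = 1`
    have hϖm : normAbs F ((ϖ ^ m : Fˣ) : F) = ((residueFieldCard F : ℝ≥0)⁻¹) ^ (m : ℤ) := by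
      rw [Units.val_pow_eq_pow_val, map_pow, hϖ, zpow_natCast]
    have hq0 : ((residueFieldCard F : ℝ≥0)⁻¹) ^ (m : ℤ) ≠ 0 := zpow_ne_zero _ inv_residueFieldCard_pos.ne'
    have hu : normAbs F ((((ϖ ^ m)⁻¹ * a : Fˣ)) : F) = 1 := by
      rw [Units.val_mul, map_mul, Units.val_inv_eq_inv_val, map_inv₀, hϖm, ha, inv_mul_cancel₀ hq0]
    have hW : W (diagGL2 a 1) = c ^ m * W 1 := by
      rw [← h1 m _ hu, mul_inv_cancel_left]
    have habs : (((normAbs F (a : F) : ℝ≥0) : ℝ) : ℂ) ^ (s - 1 / 2) = ((x : ℂ) ^ (s - 1 / 2)) ^ m := by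
      rw [ha, zpow_natCast, NNReal.coe_pow, ofReal_pow_cpow hx0]
    rw [hW, habs, hzdef, mul_pow]
    ring
  · simp_rw [norm_mul, norm_pow]
    exact (summable_geometric_of_lt_one (norm_nonneg _) hz).mul_left _

end Zeta

/-! ### Part L5: the zeta integral has a pole — the `hZ` witness -/

section NotLaurent

variable {F : Type*} [Field F] [ValuativeRel F] [TopologicalSpace F] [IsNonarchimedeanLocalField F]

/-- A divisor of `X^k` does not vanish at a non-zero point. [folklore] -/
theorem eval_ne_zero_of_dvd_X_pow {p : ℂ[X]} {k : ℕ} (hp : p ∣ X ^ k) {t : ℂ} (ht : t ≠ 0) :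
    p.eval t ≠ 0 := by
  obtain ⟨r, hr⟩ := hp
  intro h
  have h1 : (X ^ k : ℂ[X]).eval t = 0 := by rw [hr, eval_mul, h, zero_mul]
  rw [eval_pow, eval_X] at h1
  exact pow_ne_zero k ht h1

/-- Evaluation of a Laurent polynomial `Q / X^k` at `t ≠ 0`: `(Q/X^k)(t) · t^k = Q(t)`
(`RatFunc.eval` with its reduced-fraction convention). [folklore] -/
theorem ratFunc_eval_laurent_mul_pow (Q : ℂ[X]) (k : ℕ) {t : ℂ} (ht : t ≠ 0) :
    (algebraMap ℂ[X] (RatFunc ℂ) Q / RatFunc.X ^ k).eval (RingHom.id ℂ) t * t ^ k = Q.eval t := by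
  set R : RatFunc ℂ := algebraMap ℂ[X] (RatFunc ℂ) Q / RatFunc.X ^ k with hR
  have hXk : (RatFunc.X : RatFunc ℂ) ^ k = algebraMap ℂ[X] (RatFunc ℂ) (X ^ k) := by
    rw [map_pow, RatFunc.algebraMap_X]
  have hRX : R * RatFunc.X ^ k = algebraMap ℂ[X] (RatFunc ℂ) Q := by
    rw [hR, div_mul_cancel₀]
    rw [hXk]
    exact (map_ne_zero_iff _ (IsFractionRing.injective ℂ[X] (RatFunc ℂ))).2 (pow_ne_zero k X_ne_zero)
  have hdenR : Polynomial.eval₂ (RingHom.id ℂ) t R.denom ≠ 0 := by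
    have hdvd : R.denom ∣ X ^ k := by
      rw [hR, hXk]
      exact RatFunc.denom_div_dvd Q (X ^ k)
    rw [Polynomial.eval₂_id]
    exact eval_ne_zero_of_dvd_X_pow hdvd ht
  have hdenX : Polynomial.eval₂ (RingHom.id ℂ) t ((RatFunc.X : RatFunc ℂ) ^ k).denom ≠ 0 := by
    rw [hXk, RatFunc.denom_algebraMap, Polynomial.eval₂_one]
    exact one_ne_zero
  have h := congrArg (RatFunc.eval (RingHom.id ℂ) t) hRX
  rw [RatFunc.eval_mul (RingHom.id ℂ) t hdenR hdenX, hXk, RatFunc.eval_algebraMap,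
    RatFunc.eval_algebraMap, Polynomial.eval₂_id, Polynomial.eval₂_id] at h
  simpa only [Algebra.algebraMap_self, RingHom.id_apply, eval_pow, eval_X] using h

/-- `A / (1 - α T)` with `A ≠ 0 ≠ α` is not a Laurent polynomial: if
`Q(t_j) (1 - α t_j) = A t_j^k` for infinitely many `t_j`, then `Q (1 - α X) = A X^k`, which fails
at `X = α⁻¹`. [folklore] -/
theorem not_laurent_of_geometric {Z : ℂ → ℂ} {q : ℕ} (hq : 1 < q) {A α : ℂ} (hA : A ≠ 0) (hα : α ≠ 0)
    (hZ : ∃ σ₀ : ℝ, ∀ s : ℂ, σ₀ < s.re → Z s = A * (1 - α * (q : ℂ) ^ (-s))⁻¹)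
    (R : RatFunc ℂ) (hR : IsLaurent R) : ¬ EqOnRightHalfPlane q Z R := by
  rintro ⟨c₁, hc₁⟩
  obtain ⟨Q, k, rfl⟩ := hR
  obtain ⟨σ₀, hσ₀⟩ := hZ
  have hq1 : (1 : ℝ) < q := by exact_mod_cast hq
  have hq0 : (q : ℂ) ≠ 0 := Nat.cast_ne_zero.2 (by omega)
  -- sample points `t_j = q^{-j}`, `j ≥ K`
  obtain ⟨K₁, hK₁⟩ : ∃ K₁ : ℕ, ∀ j : ℕ, K₁ ≤ j → max c₁ σ₀ < ((j : ℂ)).re := by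
    obtain ⟨K₁, hK₁⟩ := exists_nat_gt (max c₁ σ₀)
    exact ⟨K₁, fun j hj => by rw [Complex.natCast_re]; exact hK₁.trans_le (by exact_mod_cast hj)⟩
  obtain ⟨K₂, hK₂⟩ : ∃ K₂ : ℕ, ∀ j : ℕ, K₂ ≤ j → ‖α * ((q : ℂ) ^ j)⁻¹‖ < 1 := by
    have ht : Filter.Tendsto (fun j : ℕ => ‖α‖ * ((q : ℝ)⁻¹) ^ j) Filter.atTop (nhds 0) := by
      rw [← mul_zero ‖α‖]
      exact (tendsto_pow_atTop_nhds_zero_of_lt_one (inv_nonneg.2 (by positivity))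
        (inv_lt_one_of_one_lt₀ hq1)).const_mul _
    obtain ⟨K₂, hK₂⟩ := Filter.eventually_atTop.1 (ht.eventually (gt_mem_nhds zero_lt_one))
    refine ⟨K₂, fun j hj => ?_⟩
    have := hK₂ j hj
    rwa [norm_mul, norm_inv, norm_pow, Complex.norm_natCast, ← inv_pow]
  set t : ℕ → ℂ := fun j => ((q : ℂ) ^ j)⁻¹ with ht
  have ht0 : ∀ j, t j ≠ 0 := fun j => inv_ne_zero (pow_ne_zero j hq0)
  -- the polynomial identity at the sample points
  have hpt : ∀ j : ℕ, max K₁ K₂ ≤ j →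
      (Q * (1 - Polynomial.C α * X)).eval (t j) = (Polynomial.C A * X ^ k).eval (t j) := by
    intro j hj
    have hj₁ := hK₁ j ((le_max_left _ _).trans hj)
    have hj₂ := hK₂ j ((le_max_right _ _).trans hj)
    have e1 := hc₁ (j : ℂ) ((le_max_left _ _).trans_lt hj₁)
    have e2 := hσ₀ (j : ℂ) ((le_max_right _ _).trans_lt hj₁)
    rw [evalAtQ_natCast] at e1
    rw [Complex.cpow_neg, Complex.cpow_natCast] at e2
    have e1' : Z j = (algebraMap ℂ[X] (RatFunc ℂ) Q / RatFunc.X ^ k).eval (RingHom.id ℂ) (t j) := e1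
    have e2' : Z j = A * (1 - α * t j)⁻¹ := e2
    have hj₂' : ‖α * t j‖ < 1 := hj₂
    have hne : (1 : ℂ) - α * t j ≠ 0 := by
      intro h
      have : ‖α * t j‖ = 1 := by rw [← sub_eq_zero.1 h, norm_one]
      exact (hj₂'.ne this)
    have e3 := ratFunc_eval_laurent_mul_pow Q k (ht0 j)
    rw [← e1', e2'] at e3
    rw [eval_mul, eval_sub, eval_one, eval_mul, eval_C, eval_X, eval_mul, eval_C, eval_pow, eval_X,
      ← e3]
    calc A * (1 - α * t j)⁻¹ * t j ^ k * (1 - α * t j)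
        = A * t j ^ k * ((1 - α * t j)⁻¹ * (1 - α * t j)) := by ring
      _ = A * t j ^ k := by rw [inv_mul_cancel₀ hne, mul_one]
  have hinf : Set.Infinite {x : ℂ | (Q * (1 - Polynomial.C α * X)).eval x = (Polynomial.C A * X ^ k).eval x} := by
    have hinj : Function.Injective t := fun i j hij => by
      have := inv_natCast_pow_injective hq (show ((q : ℂ) ^ i)⁻¹ = ((q : ℂ) ^ j)⁻¹ from hij)
      exact this
    refine ((Set.Ici_infinite (max K₁ K₂)).image hinj.injOn).mono ?_
    rintro _ ⟨j, hj, rfl⟩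
    exact hpt j hj
  have hpoly := Polynomial.eq_of_infinite_eval_eq _ _ hinf
  have h := congrArg (Polynomial.eval α⁻¹) hpoly
  rw [eval_mul, eval_sub, eval_one, eval_mul, eval_C, eval_X, mul_inv_cancel₀ hα, sub_self,
    mul_zero, eval_mul, eval_C, eval_pow, eval_X] at h
  exact (mul_ne_zero hA (pow_ne_zero k (inv_ne_zero hα))) h.symm

/-- **The new-vector zeta integral is not a Laurent polynomial** (the `hZ` witness of
`Hida2000Thm326.inertia_of_level_of_localGlobal_of_rsZeta_not_laurent`).  Let `W : GL₂(F) → ℂ`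
vanish at `d(a, 1)` for `|a| > 1` and satisfy `W(d(ϖ^m u, 1)) = c^m W(1)` (`|ϖ| = q⁻¹`, `|u| = 1`)
with `c ≠ 0` and `W(1) ≠ 0`, and let `W'` be a non-zero constant function on `GL₁(F)`.  Then for the
invariant measure `ν` on `GL₁(F) ⧸ U₁` transported from a Haar measure `μ'` of `Fˣ`
(`exists_haar_measure_quotient_fin_one`), `Ψ(s; W, W') = rsZeta ν W W' s` equals
`μ'(𝒪ˣ) κ W(1) / (1 - c q^{1/2} q^{-s})` for `re s ≫ 0` (`integral_torus_whittaker_eq` after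
`a ↦ a⁻¹`), and is therefore not equal on any right half-plane to a Laurent polynomial in `q^{-s}`
(`not_laurent_of_geometric`).  Classically: `Ψ(s; W_new) = L(s, μ₁) · const` for
`π = π(μ₁, μ₂)`, `μ₁` unramified (Jacquet–Langlands 1970, Prop. 3.5; Casselman 1973, Thm. 1).
[cite: JacquetLanglands1970, Prop. 3.5] [cite: Casselman1973, Thm. 1] -/
theorem exists_measure_rsZeta_not_laurent
    [MeasurableSpace (GL (Fin 1) F ⧸ upperUnitriangular (Fin 1) F)]
    [BorelSpace (GL (Fin 1) F ⧸ upperUnitriangular (Fin 1) F)]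
    {W : GL (Fin 2) F → ℂ} {ϖ : Fˣ} (hϖ : normAbs F (ϖ : F) = (residueFieldCard F : ℝ≥0)⁻¹) {c : ℂ}
    (hc : c ≠ 0)
    (h0 : ∀ a : Fˣ, 1 < normAbs F (a : F) → W (diagGL2 a 1) = 0)
    (h1 : ∀ (m : ℕ) (u : Fˣ), normAbs F (u : F) = 1 → W (diagGL2 (ϖ ^ m * u) 1) = c ^ m * W 1)
    (hW1 : W 1 ≠ 0) {W' : GL (Fin 1) F → ℂ} {κ : ℂ} (hW' : ∀ g, W' g = κ) (hκ : κ ≠ 0) :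
    ∃ ν : Measure (GL (Fin 1) F ⧸ upperUnitriangular (Fin 1) F),
      SMulInvariantMeasure (GL (Fin 1) F) (GL (Fin 1) F ⧸ upperUnitriangular (Fin 1) F) ν ∧
      IsFiniteMeasureOnCompacts ν ∧ ν.IsOpenPosMeasure ∧
      ∀ R : RatFunc ℂ, IsLaurent R →
        ¬ EqOnRightHalfPlane (residueFieldCard F) (rsZeta Nat.one_lt_two ν W W') R := by
  letI : MeasurableSpace F := borel F
  haveI : BorelSpace F := ⟨rfl⟩
  haveI : T2Space F :=
    (Literature.NumberTheory.GaloisRepresentations.IsNonarchimedeanLocalField.isLocalField F).toT2Space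
  haveI : BorelSpace Fˣ := Units.borelSpace
  obtain ⟨μ', hμ', ν, hinv, hfin, hpos, hint⟩ := exists_haar_measure_quotient_fin_one (F := F)
  haveI := hμ'
  haveI := isInvInvariant_of_isHaarMeasure_units μ'
  refine ⟨ν, hinv, hfin, hpos, ?_⟩
  -- constants
  have hq : 1 < residueFieldCard F := one_lt_residueFieldCard F
  set x : ℝ := (((residueFieldCard F : ℝ≥0)⁻¹ : ℝ≥0) : ℝ) with hxdef
  have hx0 : 0 < x := by rw [hxdef]; exact_mod_cast inv_residueFieldCard_pos (F := F)
  have hx1 : x < 1 := by rw [hxdef]; exact_mod_cast inv_residueFieldCard_lt_one (F := F)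
  have hxq : (x : ℂ) = ((residueFieldCard F : ℂ))⁻¹ := by
    rw [hxdef, NNReal.coe_inv, NNReal.coe_natCast, Complex.ofReal_inv, Complex.ofReal_natCast]
  have hxne : (x : ℂ) ≠ 0 := Complex.ofReal_ne_zero.2 hx0.ne'
  set A : ℂ := (μ' {x : Fˣ | valuation F (x : F) = 1}).toReal * (κ * W 1) with hAdef
  have hA : A ≠ 0 := by
    refine mul_ne_zero ?_ (mul_ne_zero hκ hW1)
    exact Complex.ofReal_ne_zero.2
      (ENNReal.toReal_pos (measure_unitSphere_pos μ').ne' (measure_unitSphere_lt_top μ').ne).ne'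
  set α : ℂ := c * (x : ℂ) ^ (-(1 / 2 : ℂ)) with hαdef
  have hα : α ≠ 0 := mul_ne_zero hc (by rw [Ne, Complex.cpow_eq_zero_iff, not_and_or]; exact Or.inl hxne)
  -- Step A: `Ψ(s) = A / (1 - α q^{-s})` for `re s` large
  have hzeta : ∃ σ₀ : ℝ, ∀ s : ℂ, σ₀ < s.re →
      rsZeta Nat.one_lt_two ν W W' s = A * (1 - α * (residueFieldCard F : ℂ) ^ (-s))⁻¹ := by
    obtain ⟨N, hN⟩ : ∃ N : ℕ, ‖c‖ * x ^ N < 1 := by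
      have ht : Filter.Tendsto (fun j : ℕ => ‖c‖ * x ^ j) Filter.atTop (nhds 0) := by
        rw [← mul_zero ‖c‖]
        exact (tendsto_pow_atTop_nhds_zero_of_lt_one hx0.le hx1).const_mul _
      obtain ⟨N, hN⟩ := Filter.eventually_atTop.1 (ht.eventually (gt_mem_nhds zero_lt_one))
      exact ⟨N, hN N le_rfl⟩
    refine ⟨N + 1 / 2, fun s hs => ?_⟩
    have hz : ‖c * (x : ℂ) ^ (s - 1 / 2)‖ < 1 := by
      rw [norm_mul, Complex.norm_cpow_eq_rpow_re_of_pos hx0, Complex.sub_re,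
        show ((1 : ℂ) / 2).re = 1 / 2 by norm_num]
      have hle : x ^ (s.re - 1 / 2) ≤ x ^ (N : ℝ) :=
        Real.rpow_le_rpow_of_exponent_ge hx0 hx1.le (by linarith)
      rw [Real.rpow_natCast] at hle
      exact lt_of_le_of_lt (mul_le_mul_of_nonneg_left hle (norm_nonneg _)) hN
    -- unfold the zeta integral down to the torus integral
    have hker : ∀ a : Fˣ, rsKernel Nat.one_lt_two W W' s
        (QuotientGroup.mk (glDiagonal 1 F fun _ => a)) =
          W (diagGL2 a⁻¹ 1) * κ * (((normAbs F ((a⁻¹ : Fˣ) : F) : ℝ≥0) : ℝ) : ℂ) ^ (s - 1 / 2) := by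
      intro a
      rw [rsKernel_mk_of_fin_one, rsIntegrand_glDiagonal_fin_one, hW']
    rw [rsZeta, hint]
    simp_rw [hker]
    have hI := integral_inv_eq_self (fun a : Fˣ => W (diagGL2 a 1) * κ *
      (((normAbs F (a : F) : ℝ≥0) : ℝ) : ℂ) ^ (s - 1 / 2)) μ'
    beta_reduce at hI
    rw [hI, integral_torus_whittaker_eq μ' hϖ h0 h1 κ s hz, hAdef, hαdef]
    have hxs' : (x : ℂ) ^ s = (residueFieldCard F : ℂ) ^ (-s) := by
      rw [hxq, Complex.inv_cpow _ _ (by rw [Complex.natCast_arg]; exact Real.pi_ne_zero.symm),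
        Complex.cpow_neg]
    have hxs : (x : ℂ) ^ (s - 1 / 2) = (x : ℂ) ^ (-(1 / 2 : ℂ)) * (residueFieldCard F : ℂ) ^ (-s) := by
      rw [show s - 1 / 2 = -(1 / 2 : ℂ) + s by ring, Complex.cpow_add _ _ hxne, hxs']
    rw [hxs]
    ring
  exact fun R hR => not_laurent_of_geometric hq hA hα hzeta R hR

/-- **The `hZ` witness from the raw new-vector data.**  Let `ψ` have conductor exponent `0`,
`|ϖ| = q⁻¹`, and let `W : GL₂(F) → ℂ` satisfy `W(n(x) g) = ψ(x) W(g)`, be right invariant under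
`n(t)` (`|t| ≤ 1`) and `d(u, 1)` (`|u| = 1`), and satisfy `∑_i W(g n(b_i) d(ϖ, 1)) = λ W(g)` with
`|b_i| ≤ 1`, `λ ≠ 0`; assume `W(1) ≠ 0` and let `W'` be a non-zero constant function on `GL₁(F)`.
Then for some invariant measure `ν` on `GL₁(F) ⧸ U₁` (finite on compacts, positive on opens) the
zeta integral `rsZeta ν W W'` is not a Laurent polynomial in `q^{-s}` on any right half-plane.
[cite: JacquetLanglands1970, Prop. 3.5] [cite: Gelbart1975, Lemma 3.7] -/
theorem exists_measure_rsZeta_not_laurent_of_newvector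
    [MeasurableSpace (GL (Fin 1) F ⧸ upperUnitriangular (Fin 1) F)]
    [BorelSpace (GL (Fin 1) F ⧸ upperUnitriangular (Fin 1) F)]
    {ψ : AddChar F Circle} (hψ : ψ.HasConductorExp 0) {W : GL (Fin 2) F → ℂ}
    (hN : ∀ (x : F) (g : GL (Fin 2) F),
      W (((unipotentGL2 x : ↥(upperUnitriangular (Fin 2) F)) : GL (Fin 2) F) * g) = ψ x * W g)
    (hn : ∀ t : F, normAbs F t ≤ 1 → ∀ g : GL (Fin 2) F,
      W (g * ((unipotentGL2 t : ↥(upperUnitriangular (Fin 2) F)) : GL (Fin 2) F)) = W g)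
    (hd : ∀ u : Fˣ, normAbs F (u : F) = 1 → ∀ g : GL (Fin 2) F, W (g * diagGL2 u 1) = W g)
    {ι : Type*} [Fintype ι] [Nonempty ι] {b : ι → F} (hb : ∀ i, normAbs F (b i) ≤ 1) {ϖ : Fˣ}
    (hϖ : normAbs F (ϖ : F) = (residueFieldCard F : ℝ≥0)⁻¹) {lam : ℂ} (hlam : lam ≠ 0)
    (hU : ∀ g : GL (Fin 2) F,
      ∑ i, W (g * (((unipotentGL2 (b i) : ↥(upperUnitriangular (Fin 2) F)) : GL (Fin 2) F) *
        diagGL2 ϖ 1)) = lam * W g)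
    (hW1 : W 1 ≠ 0) {W' : GL (Fin 1) F → ℂ} {κ : ℂ} (hW' : ∀ g, W' g = κ) (hκ : κ ≠ 0) :
    ∃ ν : Measure (GL (Fin 1) F ⧸ upperUnitriangular (Fin 1) F),
      SMulInvariantMeasure (GL (Fin 1) F) (GL (Fin 1) F ⧸ upperUnitriangular (Fin 1) F) ν ∧
      IsFiniteMeasureOnCompacts ν ∧ ν.IsOpenPosMeasure ∧
      ∀ R : RatFunc ℂ, IsLaurent R →
        ¬ EqOnRightHalfPlane (residueFieldCard F) (rsZeta Nat.one_lt_two ν W W') R := by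
  have hψ1 := addChar_eq_one_of_hasConductorExp_zero hψ
  have hϖ1 : normAbs F (ϖ : F) ≤ 1 := by rw [hϖ]; exact inv_residueFieldCard_lt_one.le
  have hcard : (Fintype.card ι : ℂ) ≠ 0 := Nat.cast_ne_zero.mpr Fintype.card_ne_zero
  refine exists_measure_rsZeta_not_laurent hϖ (c := lam / Fintype.card ι) (div_ne_zero hlam hcard)
    (fun a ha => whittaker_torus_eq_zero hN hn (exists_addChar_mul_ne_one_of_hasConductorExp_zero hψ) a ha)
    (fun m u hu => ?_) hW1 hW' hκ
  rw [whittaker_torus_unit hd ϖ m u hu, whittaker_torus_pow hψ1 hN hb hϖ1 hU m]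

end NotLaurent

end Literature.NumberTheory.EllipticCurves.Hida2000Thm326

end
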